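import Summits.MatrixMultiplication.MatrixMultiplication.Theorems.LieRankDesigns.Negative.BigCellOrth

/-!
# Negative lemmas for the crux `LieRankDesigns` (stmt-MatrixMultiplication-7614), part S3:
the BIG BRUHAT CELL of `SL_2(𝔽_p)` kills level one — the Cohn–Umans triangle is not a graded design

Continues parts S1/S2 (`BigCellSums`, `BigCellOrth`); no theorem here asserts a Theses statement
positively, and no definition is introduced.  Lead-side result of line `Sketch` (seat c2) for the card
`siegel-triangle-elliptic-twist` at `k = 1` (radical inflation in the Siegel arena `m = 2k`).

* `not_rankSep_of_translated_bigCell` — MASTER FORM (`p ≥ 5`): if a two-sided translate of the big cell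
  `{[[l, l b], [c l, c l b + l⁻¹]] : l ≠ 0}` of `SL_2(𝔽_p)` lies in the quadruple products `X⁻¹YY⁻¹Z` with
  the identity of the cell ON a target, then `(X, Y, Z)` is NOT rank-1-separated: the separating function
  of that target is `δ` on the products, so it pairs with the translated annihilator `W` of part S2 to
  `W(1) ≠ 0`, while `W` is orthogonal to `F_1`.
* `not_rankSep_of_bigCell_cosets` — coset form: `X ⊇ U⁻`, `Z ⊇ U⁺`, `Y ≠ ∅` and the middle quotient set
  `YY⁻¹` meets every double coset `U⁻·diag(l, l⁻¹)·U⁺`, `l ∉ {0, 1}` ⇒ NOT rank-1-separated.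
* `not_rankSep_of_unipotent_triangle` — `X ⊇ U⁻`, `Z ⊇ U⁺`, `Y ⊇ U_φ = {[[1 − tφ, t], [−φ²t, 1 + tφ]]}`
  (`φ ≠ 0`; the root subgroups of the three distinct lines `⟨e₂⟩, ⟨e₁⟩, ⟨e₁ + φe₂⟩` — CohnUmans2003
  Prop. 10's TPP triple `(U⁻, U_φ, U⁺) ⊂ SL_2(𝔽_p)` realising `⟨p, p, p⟩`) ⇒ NOT rank-1-separated, whatever
  else `X, Y, Z` contain (`p ≥ 5`).  So the `k = 1` case of the card's radical inflation is dead for EVERY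
  decoration: these designs have the TPP but are invisible to the level-one tests.  Numerics (evidence on
  the item, `siegel-bessel-identity-test.md`): the identity test fails at `p = 3, 5, 7`, and its level-2
  analogue for the Siegel triangle in `GL_4(𝔽_2)` fails for 33 of 49 character pairs.
-/

set_option linter.dupNamespace false

noncomputable section

namespace Summit.MatrixMultiplication.MatrixMultiplication.Theorems.LieRankDesigns.Negative

open Summit.MatrixMultiplication.MatrixMultiplication.Theses.LevelGradedCohnUmans
open Summit.MatrixMultiplication.MatrixMultiplication.Theorems.LevelOneGL2Designs.Negative

variable {p : ℕ} [Fact p.Prime]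

/-- **MASTER FORM OF THE BIG-CELL KILL** (`p ≥ 5`).  If a two-sided translate of the big cell of
`SL_2(𝔽_p)` lies inside the quadruple products `P = X⁻¹YY⁻¹Z` with the identity of the cell ON a target
(`e x₀⁻¹ z₀ f = 1`), then `(X, Y, Z)` is NOT rank-1-separated. -/
theorem not_rankSep_of_translated_bigCell (hp : 5 ≤ p) {X Y Z : Finset (GLm p 2)}
    {x₀ z₀ : GLm p 2} (hx₀ : x₀ ∈ X) (hz₀ : z₀ ∈ Z) (e f : GLm p 2)
    (htarget : e * (x₀⁻¹ * z₀) * f = 1)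
    (hP : ∀ g : GLm p 2, (∃ l b c : ZMod p, l ≠ 0 ∧
        ((e * g * f : GLm p 2) : Mat p 2) = !![l, l * b; c * l, c * l * b + l⁻¹]) →
      g ∈ quadProducts X Y Z) :
    ¬ RankSep 1 X Y Z := by
  classical
  obtain ⟨W, hW1, hsupp, horth⟩ := exists_bigCell_annihilator hp
  intro hsep
  obtain ⟨co, hco, hsepc⟩ := hsep x₀ hx₀ z₀ hz₀
  have hsum := horth co hco e f
  have hval : ∀ g : GLm p 2, W ((e * g * f : GLm p 2) : Mat p 2) * fourierFn co g
      = if g = x₀⁻¹ * z₀ then W ((e * g * f : GLm p 2) : Mat p 2) else 0 := by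
    intro g
    by_cases hw : W ((e * g * f : GLm p 2) : Mat p 2) = 0
    · rw [hw, zero_mul]
      split_ifs <;> rfl
    · obtain ⟨l, b, c, hl, hlbc⟩ := hsupp _ hw
      rw [sep_apply_of_mem_quadProducts hx₀ hz₀ hsepc (hP g ⟨l, b, c, hl, hlbc⟩)]
      by_cases hg1 : g = x₀⁻¹ * z₀ <;> simp [hg1]
  simp_rw [hval] at hsum
  rw [Finset.sum_ite_eq'] at hsum
  simp only [Finset.mem_univ, if_true, htarget] at hsum
  exact hW1 hsum

/-- **COSET FORM OF THE BIG-CELL KILL** (`p ≥ 5`).  If `X ⊇ U⁻ = {[[1,0],[c,1]]}`, `Z ⊇ U⁺ = {[[1,b],[0,1]]}`,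
`Y ≠ ∅`, and the middle quotient set `YY⁻¹` meets every double coset `U⁻·diag(l, l⁻¹)·U⁺` with
`l ∉ {0, 1}` (for each such `l` some `y y'⁻¹` is a big-cell matrix `[[l, l b], [c l, c l b + l⁻¹]]`), then
`(X, Y, Z)` is NOT rank-1-separated: the quadruple products contain the whole big cell through the target
`1 = 1⁻¹·1`.  Radical inflations `X = U⁻·𝒜`, `Z = U⁺·𝒟` (`1 ∈ 𝒜, 𝒟`) of a middle piece containing a root
subgroup in general position are all of this form (`not_rankSep_of_unipotent_triangle`). -/
theorem not_rankSep_of_bigCell_cosets (hp : 5 ≤ p) {X Y Z : Finset (GLm p 2)}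
    (hX : ∀ c : ZMod p, ∃ x ∈ X, (x : Mat p 2) = !![1, 0; c, 1])
    (hZ : ∀ b : ZMod p, ∃ z ∈ Z, (z : Mat p 2) = !![1, b; 0, 1])
    (hY : Y.Nonempty)
    (hQ : ∀ l : ZMod p, l ≠ 0 → l ≠ 1 →
      ∃ y ∈ Y, ∃ y' ∈ Y, ∃ b c : ZMod p,
        ((y * y'⁻¹ : GLm p 2) : Mat p 2) = !![l, l * b; c * l, c * l * b + l⁻¹]) :
    ¬ RankSep 1 X Y Z := by
  classical
  obtain ⟨y₀, hy₀⟩ := hY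
  -- 1 ∈ X and 1 ∈ Z
  have h1X : (1 : GLm p 2) ∈ X := by
    obtain ⟨x, hx, hxm⟩ := hX 0
    have : x = 1 := Units.ext (by rw [hxm]; ext i j; fin_cases i <;> fin_cases j <;> rfl)
    rwa [this] at hx
  have h1Z : (1 : GLm p 2) ∈ Z := by
    obtain ⟨z, hz, hzm⟩ := hZ 0
    have : z = 1 := Units.ext (by rw [hzm]; ext i j; fin_cases i <;> fin_cases j <;> rfl)
    rwa [this] at hz
  refine not_rankSep_of_translated_bigCell hp h1X h1Z 1 1 (by group) ?_
  rintro g ⟨l, b, c, hl, hg⟩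
  rw [one_mul, mul_one] at hg
  -- a middle pair realising the double coset of `l` (for `l = 1`: `y₀ y₀⁻¹ = 1`)
  obtain ⟨y, hy, y', hy', b', c', hyy⟩ : ∃ y ∈ Y, ∃ y' ∈ Y, ∃ b' c' : ZMod p,
      ((y * y'⁻¹ : GLm p 2) : Mat p 2) = !![l, l * b'; c' * l, c' * l * b' + l⁻¹] := by
    by_cases hl1 : l = 1
    · refine ⟨y₀, hy₀, y₀, hy₀, 0, 0, ?_⟩
      rw [mul_inv_cancel, hl1]
      exact (bigCell_one (p := p)).symm
    · exact hQ l hl hl1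
  -- outer pieces: x ∈ X with matrix u(c' − c) (so that x⁻¹ = u(c − c')), z ∈ Z with matrix v(b − b')
  obtain ⟨x, hx, hxm⟩ := hX (c' - c)
  obtain ⟨z, hz, hzm⟩ := hZ (b - b')
  have hxinv : ((x⁻¹ : GLm p 2) : Mat p 2) = !![1, 0; c - c', 1] := by
    rw [Matrix.coe_units_inv, hxm]
    refine Matrix.inv_eq_right_inv ?_
    ext i j
    fin_cases i <;> fin_cases j <;> simp [Matrix.mul_apply, Fin.sum_univ_two]
  have hg_eq : g = x⁻¹ * y * y'⁻¹ * z := by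
    rw [show (x⁻¹ * y * y'⁻¹ * z : GLm p 2) = x⁻¹ * (y * y'⁻¹) * z by group]
    apply Units.ext
    rw [Units.val_mul, Units.val_mul, hyy, hxinv, hzm, hg, lower_mul_bigCell_mul_upper]
    congr 1; ring
  rw [hg_eq]
  exact mem_quadProducts hx hy hy' hz

/-- **THE COHN–UMANS TRIANGLE IS NOT A LEVEL-ONE DESIGN** (`p ≥ 5`).  If `X ⊇ U⁻`, `Z ⊇ U⁺` and
`Y ⊇ U_φ = {[[1 − tφ, t], [−φ²t, 1 + tφ]] : t ∈ 𝔽_p}` for some `φ ≠ 0` (the root subgroups of three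
distinct lines: CohnUmans2003 Prop. 10's TPP triple `(U⁻, U_φ, U⁺) ⊂ SL_2(𝔽_p)` realising `⟨p, p, p⟩`),
then `(X, Y, Z)` is NOT rank-1-separated — whatever else the three sets contain.  Hence every "radical
inflation" of the Siegel triangle at `k = 1` (card `siegel-triangle-elliptic-twist`), with arbitrary Levi or
non-Levi decorations containing the base cosets, is dead as a graded design. -/
theorem not_rankSep_of_unipotent_triangle (hp : 5 ≤ p) {X Y Z : Finset (GLm p 2)} {φ : ZMod p}
    (hφ : φ ≠ 0)
    (hX : ∀ c : ZMod p, ∃ x ∈ X, (x : Mat p 2) = !![1, 0; c, 1])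
    (hZ : ∀ b : ZMod p, ∃ z ∈ Z, (z : Mat p 2) = !![1, b; 0, 1])
    (hY : ∀ t : ZMod p, ∃ y ∈ Y, (y : Mat p 2) = !![1 - t * φ, t; -(φ * φ * t), 1 + t * φ]) :
    ¬ RankSep 1 X Y Z := by
  classical
  have hY1 : (1 : GLm p 2) ∈ Y := by
    obtain ⟨y, hy, hym⟩ := hY 0
    have : y = 1 := Units.ext (by rw [hym]; ext i j; fin_cases i <;> fin_cases j <;> simp)
    rwa [this] at hy
  refine not_rankSep_of_bigCell_cosets hp hX hZ ⟨1, hY1⟩ fun l hl _ => ?_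
  obtain ⟨y, hy, hym⟩ := hY ((1 - l) * φ⁻¹)
  refine ⟨y, hy, 1, hY1, ((1 - l) * φ⁻¹) * l⁻¹, -(φ * φ * ((1 - l) * φ⁻¹)) * l⁻¹, ?_⟩
  rw [inv_one, mul_one, hym]
  exact root_eq_bigCell hφ hl

/-- **A FULL DETERMINANT FIBRE THROUGH A TARGET KILLS** (`p ≥ 5`).  If the quadruple products `X⁻¹YY⁻¹Z`
contain every `g` with `det g = det(x₀⁻¹ z₀)` for some target `(x₀, z₀)` — i.e. the whole coset `SL_2(𝔽_p)·x₀⁻¹z₀`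
— then `(X, Y, Z)` is NOT rank-1-separated (that coset contains the right translate of the big cell by the
target).  A filter for the sibling crux `LevelOneGL2Designs`: the garbage of a level-one design never fills a
determinant fibre through a target. -/
theorem not_rankSep_of_det_fibre (hp : 5 ≤ p) {X Y Z : Finset (GLm p 2)} {x₀ z₀ : GLm p 2}
    (hx₀ : x₀ ∈ X) (hz₀ : z₀ ∈ Z)
    (hP : ∀ g : GLm p 2, Matrix.det (g : Mat p 2) = Matrix.det ((x₀⁻¹ * z₀ : GLm p 2) : Mat p 2) →
      g ∈ quadProducts X Y Z) :
    ¬ RankSep 1 X Y Z := by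
  classical
  refine not_rankSep_of_translated_bigCell hp hx₀ hz₀ 1 (x₀⁻¹ * z₀)⁻¹ (by group) ?_
  rintro g ⟨l, b, c, hl, hg⟩
  apply hP
  rw [one_mul] at hg
  have h1 : Matrix.det ((g * (x₀⁻¹ * z₀)⁻¹ : GLm p 2) : Mat p 2) = 1 := by
    rw [hg]; exact det_bigCell hl b c
  have h2 : Matrix.det (((x₀⁻¹ * z₀) * (x₀⁻¹ * z₀)⁻¹ : GLm p 2) : Mat p 2) = 1 := by
    rw [mul_inv_cancel]; simp
  rw [Units.val_mul, Matrix.det_mul] at h1 h2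
  have hf : Matrix.det (((x₀⁻¹ * z₀)⁻¹ : GLm p 2) : Mat p 2) ≠ 0 := fun h => by
    rw [h, mul_zero] at h1; exact zero_ne_one h1
  exact mul_right_cancel₀ hf (h1.trans h2.symm)

end Summit.MatrixMultiplication.MatrixMultiplication.Theorems.LieRankDesigns.Negative

end
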